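import Summits.QuantumFields.BalabanUV.T4Continuum.Support.NE7LoewnerDiagramPlaquette
import Summits.QuantumFields.BalabanUV.Beta.GAN24.MonotoneTorusHodge
import Summits.QuantumFields.BalabanUV.Beta.GAN24.MonotoneShorted

/-!
# NE7LoewnerDiagramTransverse — row NE7 (node U5), route «PAIR-CAUCHY» ∕ supplier LÖW (ROUTES-NE7.md §L2.2 B3, wiring
# question W-LÖW-g4-1, the TRANSVERSE face incl. HARMONIC components): the diagram-BV lemma INSTANTIATED on the Löwner
# chain of the canonical read-outs of Bałaban's block-constrained `U = 1` fluctuation covariance through ANY TRANSVERSE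
# test-form matrix under UNIT-BLOCK constraints (`GAN24/MonotoneTorusHodge.transverse_readOut_antitone`) — every diagram
# functional of them converges under refinement, with an explicit total variation, a null tail modulus and one-datum bands

Cell `pub-balaban`, rung (B)+1 sub-cell t4, lineage `b2b-balaban-t4-ne7-p2` (CRUX PROVER NE7 #2 under the
coordinator ruling «YM redirect», 2026-08-21; generation 53; companion of `Support/NE7LoewnerDiagramPlaquette`
(p257175 ∕ v1.1 p257390: the CO-EXACT face — hard-constraint chain `plaqCov`, any rows `R`, NO binder; soft-constraint
chain `softPlaqCov`, `a′ ≥ 0`), route texts `HOME/t4/ROUTES-NE7.md` v3.9 §L2.10 J-1(a) («W-LÖW-g4-1: do the functionals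
T.5♭ instantiates at U = 1 … read through CO-EXACT test forms … (then covered), or do they need harmonic ∕ gauge
components (then not covered by `MonotoneTorusPlaquette`; `MonotoneTorusHodge`∕`MonotoneTorusSoft*` are the places to
look before proving anything)?») and `HOME/t4/b2b-balaban-t4-ne7-p2/g52/ROUTE2-NE7-P2.md` v1.7.1 §2 T.5♭ ∕ §5 item 3).
HONEST FRAMING (page 1): FIXED FINITE T⁴, rung (B)+1 = existence AND uniqueness of the `ε = L^{−K} → 0` limit of
unit-scale averaged expectations, CONDITIONAL on BetaPertH and the nine spine estimates (0/9 proved); NOT infinite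
volume, NOT a mass gap, NOT the Clay problem.  NE7 is NOT PRINTED in [Balaban1984PropagatorsI]–[Balaban1989LargeFieldII]
and NOT proved here.  Everything below is [folklore] finite-dimensional linear algebra on TREE OBJECTS; one new lemma
(positive semidefiniteness of the transverse read-outs, by the criticality of gan24-p4's `transverse_source_legit`), the
rest INSTANCES of `NE7LoewnerDiagramBV` §3∕§4 and `NE7LoewnerDiagramPlaquette` §1; no definition, no cite tag, nothing
printed asserted, no `sorry`.

WHY.  A gauge-invariant LINEAR read-out of the unit-lattice 1-form field on the torus is a transverse test form
(`T·∂ = 0`): by the discrete Poincaré lemma (`MonotoneTorusHodge.exists_potential_of_plaq_eq_zero`: closed = exact ⊕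
harmonic, harmonic 1-forms on the torus = constants) such a `T` reads the CO-EXACT (curl ∕ plaquette) components AND the
HARMONIC ones (constant 1-forms, i.e. the torus-cycle ∕ Polyakov-type linear functionals) — the second half of
W-LÖW-g4-1's kernel side.  gan24-p4's `MonotoneTorusHodge` proves that under UNIT-BLOCK constraints (`R = QvOp Lc M₀`,
read-out torus `fine Lc M₀` = the `Lc⁻¹`-sub-blocks of the unit torus `Tor M₀`) every transverse test form is a legitimate
read source (`transverse_source_legit`) and hence the canonical read-outs
`P j := (T·sread j)·critCov (hform j) (rows R j)·(T·sread j)ᴴ` satisfy `(P j − P (j+1)).PosSemidef` for EVERY `j`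
(`transverse_readOut_antitone`) — NO rate, NO constant, NO gauge fixing.  B3 needs, besides the steps, the members PSD
(§1 below, the same criticality argument as `MonotoneTorusPlaquette.plaqCov_posSemidef`); then every DIAGRAM in the
entries of `P j` has summable increments, a limit, a null tail modulus and one-datum bands (§2), exactly as on the
co-exact face.

WHAT IS PROVED ([folklore]; unit torus `Tor M₀`, `Lc ≥ 1`, any `d`, any finite test-form index type `l`, any `T` with
`T * GradOp (fine Lc M₀) 1 = 0`).
§1 **`transverse_readOut_posSemidef`** — every member `P j` of the transverse read-out chain is PSD (a covariance block).
§2 **`summable_norm_diagram_transverse_sub`** (summable increments of every diagram `Σ_x w(x)·Π_e P j (x_{s(e)}, x_{t(e)})`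
   in `j`), `tsum_norm_diagram_transverse_sub_le` (TV `≤ |E|·(re tr P 0)^{|E|}·‖w‖₁`), **`exists_tendsto_diagram_transverse`**
   (the refinement limit of every transverse diagram EXISTS), **`nullTail_re_diagram_transverse`** (null tail modulus, no
   rate — the `hconv` shape of `NE7PairwiseScaleShift.nullShift_of_split`, ROUTE2 §2 T.5♭ producer (α)),
   **`norm_diagram_transverse_sub_le_of_datum`** ∕ `norm_diagram_transverse_sub_lim_le_of_datum` ((MONO-K)₂ for
   transverse diagrams from ONE trace datum `re tr(P k₀ − P j) ≤ η₀` — the datum of `transverse_readOut_entry_dev_le`).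

HONEST LIMITS.  (i) UNIT-BLOCK constraints exactly (`R = QvOp Lc M₀`; the co-exact companion allows any `R`), torus
avatar in B5's typing, abelian ∕ linearised (`U = 1`) layer — `MonotoneTorusHodge`'s scope, inherited verbatim; (ii) WHICH
functionals T.5♭ instantiates (B12 (2.14) p. 268) is a reading of print, not decided here; LÖW-res ∕ §L2.2 B4 untouched
(the printed `b₀(k)` is a background-DERIVATIVE — NOT asserted to be a transverse diagram); (iii) B3-vol: constants
volume-extensive.  With the companion, W-LÖW-g4-1's KERNEL side is complete BY NAME for every gauge-invariant linear
read-out at `U = 1` (co-exact: any rows, hard or soft; harmonic: unit-block rows); what remains of it is the reading (ii).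
NOT NE7 (spine 0/9 unchanged), NOT BetaPertH, NOT summit progress.  HONEST DEPENDENCY: continuum YM on T⁴ ⇐ BetaPertH ∧
nine spine estimates (0/9 proved); BetaPertH ⇐ (D1) ∧ (D4) ∧ CAP+tail; G-an2-4 gates asym, D1 and NE2/3/4.
-/

noncomputable section

open Matrix Finset Filter Topology
open scoped BigOperators ComplexOrder

namespace Summit.QuantumFields.BalabanUV.T4Continuum.NE7LoewnerDiagramTransverse

open Literature.MathematicalPhysics.QuantumFieldTheory.Balaban1983to89
open Literature.MathematicalPhysics.QuantumFieldTheory.Balaban1983to89.B5Prop11Plancherel (Tor fine)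
open Literature.MathematicalPhysics.QuantumFieldTheory.Balaban1983to89.B5Action121 (GradOp)
open Literature.MathematicalPhysics.QuantumFieldTheory.Balaban1983to89.B5Block118 (QvOp)
open Summit.QuantumFields.BalabanUV.Beta.GAN24.MonotoneCoarsen (qfun qfun_le_of_isCrit qfun_crit_eq_pairing)
open Summit.QuantumFields.BalabanUV.Beta.GAN24.MonotoneCritical (critCov critCov_isHermitian isCrit_critCov)
open Summit.QuantumFields.BalabanUV.Beta.GAN24.MonotoneShorted (readOut_quad)
open Summit.QuantumFields.BalabanUV.Beta.GAN24.MonotoneTorusTower (sread rows hform hform_isHermitian hform_posSemidef)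
open Summit.QuantumFields.BalabanUV.Beta.GAN24.MonotoneTorusHodge
  (transverse_source_legit transverse_readOut_antitone transverse_readOut_entry_dev_le)
open Summit.QuantumFields.BalabanUV.T4Continuum.NE7LoewnerDiagramBV
  (diagram summable_norm_diagram_sub tsum_norm_diagram_sub_le nullTail_re_diagram exists_tendsto_diagram)
open Summit.QuantumFields.BalabanUV.T4Continuum.NE7LoewnerDiagramPlaquette
  (norm_diagram_sub_le_of_chain_dev norm_diagram_sub_lim_le_of_chain_dev)

variable {d : ℕ} (Lc : ℕ) [NeZero Lc] (M₀ : Fin d → ℕ) [hM₀ : ∀ μ, NeZero (M₀ μ)]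
variable {l : Type*} [Fintype l]

/-! ## §1 The members of the transverse read-out chain are positive semidefinite -/

/-- **THE TRANSVERSE READ-OUTS ARE PSD.**  For every test-form matrix `T` with transverse rows (`T * GradOp _ 1 = 0`) and
every level `j`, `P j = (T·sread j)·critCov (hform j) (rows (QvOp Lc M₀) j)·(T·sread j)ᴴ` is positive semidefinite: its
quadratic form at `u` is the critical value of the constrained Gaussian variational problem with the LEGITIMATE source
`(T·sread j)ᴴ u` (`MonotoneTorusHodge.transverse_source_legit`), which dominates the value `0` at `v = 0` — the argument
of `MonotoneTorusPlaquette.plaqCov_posSemidef` ∕ `MonotoneTorusSoft.softPlaqCov_posSemidef` verbatim. [folklore] -/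
theorem transverse_readOut_posSemidef (T : Matrix l (Tor (fine Lc M₀) × Fin d) ℂ) (hT : T * GradOp (fine Lc M₀) 1 = 0)
    (j : ℕ) :
    ((T * sread Lc (fine Lc M₀) j) * critCov (hform_isHermitian Lc (fine Lc M₀) j) (rows Lc (fine Lc M₀) (QvOp Lc M₀) j)
        * (T * sread Lc (fine Lc M₀) j)ᴴ).PosSemidef := by
  refine PosSemidef.of_dotProduct_mulVec_nonneg
    (Matrix.isHermitian_mul_mul_conjTranspose _ (critCov_isHermitian _ _)) fun u => ?_
  rw [readOut_quad]
  set r := (T * sread Lc (fine Lc M₀) j)ᴴ *ᵥ u with hr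
  have hTt : (GradOp (fine Lc M₀) 1)ᴴ *ᵥ (Tᴴ *ᵥ u) = 0 := by
    rw [mulVec_mulVec, ← conjTranspose_mul, hT, conjTranspose_zero, zero_mulVec]
  have hleg : ∀ z, rows Lc (fine Lc M₀) (QvOp Lc M₀) j *ᵥ z = 0 → hform Lc (fine Lc M₀) j *ᵥ z = 0 →
      star z ⬝ᵥ r = 0 := by
    intro z hzR hzH
    rw [hr, conjTranspose_mul, ← mulVec_mulVec]
    exact transverse_source_legit Lc M₀ (Tᴴ *ᵥ u) hTt j z hzR hzH
  have hv := isCrit_critCov (hform_posSemidef Lc (fine Lc M₀) j) (rows Lc (fine Lc M₀) (QvOp Lc M₀) j) hleg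
  rw [← qfun_crit_eq_pairing hv]
  have h0 := qfun_le_of_isCrit (hform_posSemidef Lc (fine Lc M₀) j) hv (Submodule.zero_mem _)
  have e0 : qfun (hform Lc (fine Lc M₀) j) r 0 = 0 := by simp [qfun]
  rw [e0] at h0
  exact h0

/-! ## §2 The transverse read-out chain plugged into B3 -/

variable {ε ι : Type*} [Fintype ε] [DecidableEq ε] [Fintype ι] [DecidableEq ι]

/-- **EVERY DIAGRAM IN THE TRANSVERSE READ-OUTS HAS SUMMABLE INCREMENTS UNDER REFINEMENT** — for every transverse
test-form matrix `T` (the only binder), unit torus `Tor M₀`, `Lc ≥ 1`, `d`, multigraph `(src, tgt)` and weight `w`: B3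
(`NE7LoewnerDiagramBV.summable_norm_diagram_sub`) on the tree chain `transverse_readOut_antitone` ∕ §1. [folklore] -/
theorem summable_norm_diagram_transverse_sub (T : Matrix l (Tor (fine Lc M₀) × Fin d) ℂ)
    (hT : T * GradOp (fine Lc M₀) 1 = 0) (src tgt : ε → ι) (w : (ι → l) → ℂ) :
    Summable fun j => ‖diagram src tgt w ((T * sread Lc (fine Lc M₀) j)
          * critCov (hform_isHermitian Lc (fine Lc M₀) j) (rows Lc (fine Lc M₀) (QvOp Lc M₀) j)
          * (T * sread Lc (fine Lc M₀) j)ᴴ)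
      - diagram src tgt w ((T * sread Lc (fine Lc M₀) (j + 1))
          * critCov (hform_isHermitian Lc (fine Lc M₀) (j + 1)) (rows Lc (fine Lc M₀) (QvOp Lc M₀) (j + 1))
          * (T * sread Lc (fine Lc M₀) (j + 1))ᴴ)‖ := by
  have h := summable_norm_diagram_sub
    (P := fun j => (T * sread Lc (fine Lc M₀) j)
      * critCov (hform_isHermitian Lc (fine Lc M₀) j) (rows Lc (fine Lc M₀) (QvOp Lc M₀) j)
      * (T * sread Lc (fine Lc M₀) j)ᴴ) (k₀ := 0)
    (fun j _ => transverse_readOut_antitone Lc M₀ T hT j) (fun j _ => transverse_readOut_posSemidef Lc M₀ T hT j)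
    src tgt w
  exact h

/-- … with TOTAL VARIATION `≤ |E|·(re tr P 0)^{|E|}·Σ_x ‖w x‖` (head = the coarsest level). [folklore] -/
theorem tsum_norm_diagram_transverse_sub_le (T : Matrix l (Tor (fine Lc M₀) × Fin d) ℂ)
    (hT : T * GradOp (fine Lc M₀) 1 = 0) (src tgt : ε → ι) (w : (ι → l) → ℂ) :
    ∑' j, ‖diagram src tgt w ((T * sread Lc (fine Lc M₀) j)
          * critCov (hform_isHermitian Lc (fine Lc M₀) j) (rows Lc (fine Lc M₀) (QvOp Lc M₀) j)
          * (T * sread Lc (fine Lc M₀) j)ᴴ)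
      - diagram src tgt w ((T * sread Lc (fine Lc M₀) (j + 1))
          * critCov (hform_isHermitian Lc (fine Lc M₀) (j + 1)) (rows Lc (fine Lc M₀) (QvOp Lc M₀) (j + 1))
          * (T * sread Lc (fine Lc M₀) (j + 1))ᴴ)‖ ≤
      (Fintype.card ε : ℝ) *
        ((T * sread Lc (fine Lc M₀) 0)
          * critCov (hform_isHermitian Lc (fine Lc M₀) 0) (rows Lc (fine Lc M₀) (QvOp Lc M₀) 0)
          * (T * sread Lc (fine Lc M₀) 0)ᴴ).trace.re ^ Fintype.card ε * ∑ x : ι → l, ‖w x‖ := by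
  have h := tsum_norm_diagram_sub_le
    (P := fun j => (T * sread Lc (fine Lc M₀) j)
      * critCov (hform_isHermitian Lc (fine Lc M₀) j) (rows Lc (fine Lc M₀) (QvOp Lc M₀) j)
      * (T * sread Lc (fine Lc M₀) j)ᴴ) (k₀ := 0)
    (fun j _ => transverse_readOut_antitone Lc M₀ T hT j) (fun j _ => transverse_readOut_posSemidef Lc M₀ T hT j)
    src tgt w
  exact h

/-- **THE REFINEMENT LIMIT OF EVERY TRANSVERSE DIAGRAM EXISTS** (existence only; no identification with a continuum
object claimed). [folklore] -/
theorem exists_tendsto_diagram_transverse (T : Matrix l (Tor (fine Lc M₀) × Fin d) ℂ)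
    (hT : T * GradOp (fine Lc M₀) 1 = 0) (src tgt : ε → ι) (w : (ι → l) → ℂ) :
    ∃ Finf : ℂ, Tendsto (fun j => diagram src tgt w ((T * sread Lc (fine Lc M₀) j)
          * critCov (hform_isHermitian Lc (fine Lc M₀) j) (rows Lc (fine Lc M₀) (QvOp Lc M₀) j)
          * (T * sread Lc (fine Lc M₀) j)ᴴ)) atTop (𝓝 Finf) := by
  have h := exists_tendsto_diagram
    (P := fun j => (T * sread Lc (fine Lc M₀) j)
      * critCov (hform_isHermitian Lc (fine Lc M₀) j) (rows Lc (fine Lc M₀) (QvOp Lc M₀) j)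
      * (T * sread Lc (fine Lc M₀) j)ᴴ) (k₀ := 0)
    (fun j _ => transverse_readOut_antitone Lc M₀ T hT j) (fun j _ => transverse_readOut_posSemidef Lc M₀ T hT j)
    src tgt w
  exact h

/-- **NULL TAIL MODULUS, NO RATE, FOR THE REAL PART OF EVERY TRANSVERSE DIAGRAM** (the `hconv` shape of
`NE7PairwiseScaleShift.nullShift_of_split`, now for read-outs with harmonic components too). [folklore] -/
theorem nullTail_re_diagram_transverse (T : Matrix l (Tor (fine Lc M₀) × Fin d) ℂ)
    (hT : T * GradOp (fine Lc M₀) 1 = 0) (src tgt : ε → ι) (w : (ι → l) → ℂ) :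
    ∃ Finf : ℝ, ∃ c₀ : ℕ → ℝ,
      (∀ k j, k ≤ j → |(diagram src tgt w ((T * sread Lc (fine Lc M₀) j)
          * critCov (hform_isHermitian Lc (fine Lc M₀) j) (rows Lc (fine Lc M₀) (QvOp Lc M₀) j)
          * (T * sread Lc (fine Lc M₀) j)ᴴ)).re - Finf| ≤ c₀ k) ∧ Tendsto c₀ atTop (𝓝 0) := by
  have h := nullTail_re_diagram
    (P := fun j => (T * sread Lc (fine Lc M₀) j)
      * critCov (hform_isHermitian Lc (fine Lc M₀) j) (rows Lc (fine Lc M₀) (QvOp Lc M₀) j)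
      * (T * sread Lc (fine Lc M₀) j)ᴴ) (k₀ := 0)
    (fun j _ => transverse_readOut_antitone Lc M₀ T hT j) (fun j _ => transverse_readOut_posSemidef Lc M₀ T hT j)
    src tgt w
  exact h

/-- **(MONO-K)₂ FOR TRANSVERSE DIAGRAMS FROM ONE TRACE DATUM — NO RATE**: ONE number `η₀` with `re tr(P k₀ − P j) ≤ η₀`
for all `j ≥ k₀` bands every entry (`transverse_readOut_entry_dev_le`, BY NAME) and hence every diagram between two depths `≥ k₀` by
`|E|·(re tr P k₀)^{|E|−1}·η₀·Σ_x ‖w x‖`. [folklore] -/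
theorem norm_diagram_transverse_sub_le_of_datum (T : Matrix l (Tor (fine Lc M₀) × Fin d) ℂ)
    (hT : T * GradOp (fine Lc M₀) 1 = 0) {k₀ : ℕ} {η₀ : ℝ}
    (hdat : ∀ j, k₀ ≤ j →
      ((T * sread Lc (fine Lc M₀) k₀)
          * critCov (hform_isHermitian Lc (fine Lc M₀) k₀) (rows Lc (fine Lc M₀) (QvOp Lc M₀) k₀)
          * (T * sread Lc (fine Lc M₀) k₀)ᴴ
        - (T * sread Lc (fine Lc M₀) j)
          * critCov (hform_isHermitian Lc (fine Lc M₀) j) (rows Lc (fine Lc M₀) (QvOp Lc M₀) j)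
          * (T * sread Lc (fine Lc M₀) j)ᴴ).trace.re ≤ η₀)
    (src tgt : ε → ι) (w : (ι → l) → ℂ) :
    ∀ j j', k₀ ≤ j → k₀ ≤ j' →
      ‖diagram src tgt w ((T * sread Lc (fine Lc M₀) j)
          * critCov (hform_isHermitian Lc (fine Lc M₀) j) (rows Lc (fine Lc M₀) (QvOp Lc M₀) j)
          * (T * sread Lc (fine Lc M₀) j)ᴴ)
        - diagram src tgt w ((T * sread Lc (fine Lc M₀) j')
          * critCov (hform_isHermitian Lc (fine Lc M₀) j') (rows Lc (fine Lc M₀) (QvOp Lc M₀) j')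
          * (T * sread Lc (fine Lc M₀) j')ᴴ)‖ ≤
      (Fintype.card ε : ℝ) *
        ((T * sread Lc (fine Lc M₀) k₀)
          * critCov (hform_isHermitian Lc (fine Lc M₀) k₀) (rows Lc (fine Lc M₀) (QvOp Lc M₀) k₀)
          * (T * sread Lc (fine Lc M₀) k₀)ᴴ).trace.re ^ (Fintype.card ε - 1) * η₀ * ∑ x : ι → l, ‖w x‖ := by
  intro j j' hj hj'
  have hdev := (transverse_readOut_entry_dev_le Lc M₀ T hT hdat).1 j j' hj hj'
  have h := norm_diagram_sub_le_of_chain_dev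
    (P := fun j => (T * sread Lc (fine Lc M₀) j)
      * critCov (hform_isHermitian Lc (fine Lc M₀) j) (rows Lc (fine Lc M₀) (QvOp Lc M₀) j)
      * (T * sread Lc (fine Lc M₀) j)ᴴ) (k₀ := k₀)
    (fun j _ => transverse_readOut_antitone Lc M₀ T hT j) (fun j _ => transverse_readOut_posSemidef Lc M₀ T hT j)
    hj hj' hdev src tgt w
  exact h

/-- … and the same band to the refinement limit `F_∞` of `exists_tendsto_diagram_transverse`, for every `j ≥ k₀`.
[folklore] -/
theorem norm_diagram_transverse_sub_lim_le_of_datum (T : Matrix l (Tor (fine Lc M₀) × Fin d) ℂ)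
    (hT : T * GradOp (fine Lc M₀) 1 = 0) {k₀ : ℕ} {η₀ : ℝ}
    (hdat : ∀ j, k₀ ≤ j →
      ((T * sread Lc (fine Lc M₀) k₀)
          * critCov (hform_isHermitian Lc (fine Lc M₀) k₀) (rows Lc (fine Lc M₀) (QvOp Lc M₀) k₀)
          * (T * sread Lc (fine Lc M₀) k₀)ᴴ
        - (T * sread Lc (fine Lc M₀) j)
          * critCov (hform_isHermitian Lc (fine Lc M₀) j) (rows Lc (fine Lc M₀) (QvOp Lc M₀) j)
          * (T * sread Lc (fine Lc M₀) j)ᴴ).trace.re ≤ η₀)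
    (src tgt : ε → ι) (w : (ι → l) → ℂ) {Finf : ℂ}
    (hlim : Tendsto (fun j => diagram src tgt w ((T * sread Lc (fine Lc M₀) j)
          * critCov (hform_isHermitian Lc (fine Lc M₀) j) (rows Lc (fine Lc M₀) (QvOp Lc M₀) j)
          * (T * sread Lc (fine Lc M₀) j)ᴴ)) atTop (𝓝 Finf)) :
    ∀ j, k₀ ≤ j →
      ‖diagram src tgt w ((T * sread Lc (fine Lc M₀) j)
          * critCov (hform_isHermitian Lc (fine Lc M₀) j) (rows Lc (fine Lc M₀) (QvOp Lc M₀) j)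
          * (T * sread Lc (fine Lc M₀) j)ᴴ) - Finf‖ ≤
      (Fintype.card ε : ℝ) *
        ((T * sread Lc (fine Lc M₀) k₀)
          * critCov (hform_isHermitian Lc (fine Lc M₀) k₀) (rows Lc (fine Lc M₀) (QvOp Lc M₀) k₀)
          * (T * sread Lc (fine Lc M₀) k₀)ᴴ).trace.re ^ (Fintype.card ε - 1) * η₀ * ∑ x : ι → l, ‖w x‖ := by
  have h := norm_diagram_sub_lim_le_of_chain_dev
    (P := fun j => (T * sread Lc (fine Lc M₀) j)
      * critCov (hform_isHermitian Lc (fine Lc M₀) j) (rows Lc (fine Lc M₀) (QvOp Lc M₀) j)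
      * (T * sread Lc (fine Lc M₀) j)ᴴ) (k₀ := k₀)
    (fun j _ => transverse_readOut_antitone Lc M₀ T hT j) (fun j _ => transverse_readOut_posSemidef Lc M₀ T hT j)
    (k₁ := k₀) le_rfl (fun j j' hj hj' => (transverse_readOut_entry_dev_le Lc M₀ T hT hdat).1 j j' hj hj') src tgt w hlim
  exact h

end Summit.QuantumFields.BalabanUV.T4Continuum.NE7LoewnerDiagramTransverse

end
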